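import Literature.AlgebraicGeometry.Morphisms.FormalModuleTower
import HarnessLib

/-!
# Descent of morphisms along the transition maps of a formal tower ("shift principle")

Görtz–Wedhorn, *Algebraic Geometry II* (2023), §(24.18)–(24.20); The Stacks Project, Tag 087X /
088A: morphisms between coherent formal modules are routinely constructed "up to an Artin–Rees
shift": one has compatible maps `ψ_n : 𝓕_{c+n} → 𝒯_n` into a system whose `n`-th level is killed by
`aⁿ⁺¹`, and since `𝓕_n = 𝓕_{c+n}/aⁿ⁺¹𝓕_{c+n}` they descend uniquely to a morphism of systems
`𝓕 → 𝒯`. For the tree's quotient model (`Morphisms/FormalModuleTower`: `IsFormalTower a F` —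
`aⁿ⁺¹F_n = 0`, `F_{n+1} ↠ F_n` with `F_{n+1} —aⁿ⁺¹→ F_{n+1} → F_n` exact):

* `IsFormalTower.map_homOfLE_succ` — `F_{m+1} → F_n` is `F_{m+1} → F_m → F_n`;
* `IsFormalTower.existsUnique_desc` — **`F_m → F_n` (`n ≤ m`) is a cokernel of `aⁿ⁺¹` on `F_m`**:
  a morphism `k : F_m → W` with `aⁿ⁺¹k = 0` factors uniquely through `F_n`;
* `IsFormalTower.existsUnique_shiftDesc` — **the shift principle**: compatible
  `ψ_n : F_{c+n} → T_n` with `aⁿ⁺¹T_n = 0` descend uniquely to `θ : F ⟶ T` with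
  `(F_{c+n} → F_n) ≫ θ_n = ψ_n`; `IsFormalTower.shiftDesc` and its characterisation.

Everything is proved; no named facts.

## References

* U. Görtz, T. Wedhorn, *Algebraic Geometry II: Cohomology of Schemes*, Springer Spektrum (2023),
  (24.18.1) and Rem. 24.92 (pp. 562–565). [GortzWedhorn2023]
* The Stacks Project, Tag 087X, Tag 088A. [StacksProject]
-/

noncomputable section

-- `TopCat.Presheaf`/`Scheme.Modules` are not reducible (as in Mathlib's `AlgebraicGeometry/Modules`).
set_option backward.isDefEq.respectTransparency false

open CategoryTheory AlgebraicGeometry Limits TopologicalSpace Opposite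
open Literature.AlgebraicGeometry.Modules

universe u

namespace Literature.AlgebraicGeometry.Morphisms

variable {X : Scheme.{u}} {a : Γ(X, ⊤)} {F : ℕᵒᵖ ⥤ X.Modules}

/-- `F_{m+1} → F_n` is `F_{m+1} → F_m → F_n` (`n ≤ m`). [folklore] -/
@[reassoc]
theorem map_homOfLE_succ (F : ℕᵒᵖ ⥤ X.Modules) {n m : ℕ} (h : n ≤ m) :
    F.map (homOfLE (Nat.le_succ_of_le h)).op = towerπ F m ≫ F.map (homOfLE h).op := by
  rw [show (homOfLE (Nat.le_succ_of_le h)).op = (homOfLE (Nat.le_succ m)).op ≫ (homOfLE h).op from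
    Subsingleton.elim _ _, F.map_comp]

/-- `F_n → F_n` along `le_rfl` is the identity. [folklore] -/
theorem map_homOfLE_refl (F : ℕᵒᵖ ⥤ X.Modules) (n : ℕ) : F.map (homOfLE (le_refl n)).op = 𝟙 _ := by
  rw [show (homOfLE (le_refl n)).op = 𝟙 (⟨n⟩ : ℕᵒᵖ) from Subsingleton.elim _ _, F.map_id]

/-- `F_{c+n+1} → F_{n+1} → F_n` is `F_{c+n+1} → F_{c+n} → F_n`. [folklore] -/
@[reassoc]
theorem map_add_comm_sq (F : ℕᵒᵖ ⥤ X.Modules) (c n : ℕ) :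
    F.map (homOfLE (Nat.le_add_left (n + 1) c)).op ≫ towerπ F n =
      towerπ F (c + n) ≫ F.map (homOfLE (Nat.le_add_left n c)).op := by
  rw [← F.map_comp, ← F.map_comp]
  exact congrArg F.map (Subsingleton.elim _ _)

namespace IsFormalTower

variable (hF : IsFormalTower a F)
include hF

/-- One step: a morphism `k : F_{m+1} → W` with `aᵐ⁺¹k = 0` factors uniquely through `F_{m+1} → F_m`
(which is the cokernel of `aᵐ⁺¹`). [cite: GortzWedhorn2023, (24.18.1) (p. 562)] -/
theorem existsUnique_desc_towerπ (m : ℕ) {W : X.Modules} (k : F.obj ⟨m + 1⟩ ⟶ W)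
    (w : globalScalar (F.obj ⟨m + 1⟩) (a ^ (m + 1)) ≫ k = 0) :
    ∃! k' : F.obj ⟨m⟩ ⟶ W, towerπ F m ≫ k' = k := by
  haveI := hF.epi m
  let hc := (hF.exact m).gIsCokernel
  refine ⟨hc.desc (CokernelCofork.ofπ k w), hc.fac (CokernelCofork.ofπ k w) WalkingParallelPair.one,
    fun k'' hk'' => ?_⟩
  rw [← cancel_epi (towerπ F m), hk'']
  exact (hc.fac (CokernelCofork.ofπ k w) WalkingParallelPair.one).symm

/-- **`F_m → F_n` is a cokernel of `aⁿ⁺¹` on `F_m`** (`n ≤ m`): a morphism `k : F_m → W` with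
`aⁿ⁺¹k = 0` factors uniquely through `F_n` (induction on `m`, each `F_{m+1} → F_m` being the cokernel
of `aᵐ⁺¹ ∈ (aⁿ⁺¹)`). [cite: GortzWedhorn2023, (24.18.1) (p. 562)] -/
theorem existsUnique_desc {n m : ℕ} (h : n ≤ m) {W : X.Modules} (k : F.obj ⟨m⟩ ⟶ W)
    (w : globalScalar (F.obj ⟨m⟩) (a ^ (n + 1)) ≫ k = 0) :
    ∃! k' : F.obj ⟨n⟩ ⟶ W, F.map (homOfLE h).op ≫ k' = k := by
  induction m, h using Nat.le_induction generalizing W with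
  | base =>
    refine ⟨k, ?_, fun k'' hk'' => ?_⟩
    · change F.map (homOfLE (le_refl n)).op ≫ k = k
      rw [map_homOfLE_refl, Category.id_comp]
    · change F.map (homOfLE (le_refl n)).op ≫ k'' = k at hk''
      rwa [map_homOfLE_refl, Category.id_comp] at hk''
  | succ m hnm ih =>
    -- descend along `F_{m+1} → F_m` first: `aᵐ⁺¹ = aⁿ⁺¹·a^{m-n}` kills `k`
    have w' : globalScalar (F.obj ⟨m + 1⟩) (a ^ (m + 1)) ≫ k = 0 := by
      rw [show a ^ (m + 1) = a ^ (n + 1) * a ^ (m - n) by rw [← pow_add]; congr 1; omega,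
        globalScalar_mul, Category.assoc, w, comp_zero]
    obtain ⟨k₁, hk₁, -⟩ := hF.existsUnique_desc_towerπ m k w'
    have w₁ : globalScalar (F.obj ⟨m⟩) (a ^ (n + 1)) ≫ k₁ = 0 := by
      haveI := hF.epi m
      rw [← cancel_epi (towerπ F m), ← Category.assoc, ← globalScalar_comp, Category.assoc, hk₁, w,
        comp_zero]
    obtain ⟨k', hk', huniq⟩ := ih k₁ w₁
    refine ⟨k', ?_, fun k'' hk'' => ?_⟩
    · change F.map (homOfLE (Nat.le_succ_of_le hnm)).op ≫ k' = k
      rw [map_homOfLE_succ F hnm, Category.assoc, hk', hk₁]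
    · change F.map (homOfLE (Nat.le_succ_of_le hnm)).op ≫ k'' = k at hk''
      haveI := hF.epi_map (Nat.le_succ_of_le hnm)
      rw [← cancel_epi (F.map (homOfLE (Nat.le_succ_of_le hnm)).op), hk'', map_homOfLE_succ F hnm,
        Category.assoc, hk', hk₁]

/-! ### The shift principle -/

variable (T : ℕᵒᵖ ⥤ X.Modules) (hT : ∀ n, globalScalar (T.obj ⟨n⟩) (a ^ (n + 1)) = 0) (c : ℕ)
  (ψ : ∀ n, F.obj ⟨c + n⟩ ⟶ T.obj ⟨n⟩)
  (hψ : ∀ n, towerπ F (c + n) ≫ ψ n = ψ (n + 1) ≫ towerπ T n)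

include hT in
/-- The level-`n` descent of `ψ_n : F_{c+n} → T_n` to `F_n` (unique). [folklore] -/
theorem existsUnique_shiftDescApp (n : ℕ) :
    ∃! θ : F.obj ⟨n⟩ ⟶ T.obj ⟨n⟩, F.map (homOfLE (Nat.le_add_left n c)).op ≫ θ = ψ n :=
  hF.existsUnique_desc (Nat.le_add_left n c) (ψ n) (by rw [globalScalar_comp, hT n, comp_zero])

/-- The components of the shift descent. [folklore] -/
def shiftDescApp (n : ℕ) : F.obj ⟨n⟩ ⟶ T.obj ⟨n⟩ :=
  (hF.existsUnique_shiftDescApp T hT c ψ n).choose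

/-- Characterisation of the components: `(F_{c+n} → F_n) ≫ θ_n = ψ_n`. [folklore] -/
@[reassoc]
theorem map_shiftDescApp (n : ℕ) :
    F.map (homOfLE (Nat.le_add_left n c)).op ≫ hF.shiftDescApp T hT c ψ n = ψ n :=
  (hF.existsUnique_shiftDescApp T hT c ψ n).choose_spec.1

/-- Uniqueness of the components. [folklore] -/
theorem shiftDescApp_unique (n : ℕ) (θ : F.obj ⟨n⟩ ⟶ T.obj ⟨n⟩)
    (hθ : F.map (homOfLE (Nat.le_add_left n c)).op ≫ θ = ψ n) : θ = hF.shiftDescApp T hT c ψ n :=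
  (hF.existsUnique_shiftDescApp T hT c ψ n).choose_spec.2 θ hθ

include hψ in
/-- The components are compatible with the transition maps. [folklore] -/
theorem towerπ_shiftDescApp (n : ℕ) :
    towerπ F n ≫ hF.shiftDescApp T hT c ψ n = hF.shiftDescApp T hT c ψ (n + 1) ≫ towerπ T n := by
  haveI := hF.epi_map (Nat.le_add_left (n + 1) c)
  rw [← cancel_epi (F.map (homOfLE (Nat.le_add_left (n + 1) c)).op), map_shiftDescApp_assoc,
    map_add_comm_sq_assoc, map_shiftDescApp, hψ]

/-- **The shift principle**: compatible `ψ_n : F_{c+n} → T_n` (`aⁿ⁺¹T_n = 0`) descend to a morphism of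
towers `F ⟶ T`. [cite: StacksProject, Tag 088A] -/
def shiftDesc : F ⟶ T :=
  NatTrans.ofOpSequence (fun n => hF.shiftDescApp T hT c ψ n) fun n =>
    hF.towerπ_shiftDescApp T hT c ψ hψ n

/-- Components of `shiftDesc`. [folklore] -/
@[simp]
theorem shiftDesc_app (n : ℕ) : (hF.shiftDesc T hT c ψ hψ).app ⟨n⟩ = hF.shiftDescApp T hT c ψ n := rfl

/-- **Characterisation of `shiftDesc`**: `(F_{c+n} → F_n) ≫ θ_n = ψ_n`. [cite: StacksProject, Tag 088A] -/
@[reassoc]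
theorem map_shiftDesc_app (n : ℕ) :
    F.map (homOfLE (Nat.le_add_left n c)).op ≫ (hF.shiftDesc T hT c ψ hψ).app ⟨n⟩ = ψ n :=
  hF.map_shiftDescApp T hT c ψ n

/-- **Uniqueness in the shift principle**: a morphism of towers `θ : F ⟶ T` with
`(F_{c+n} → F_n) ≫ θ_n = ψ_n` for all `n` is `shiftDesc`. [cite: StacksProject, Tag 088A] -/
theorem eq_shiftDesc (θ : F ⟶ T) (hθ : ∀ n, F.map (homOfLE (Nat.le_add_left n c)).op ≫ θ.app ⟨n⟩ = ψ n) :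
    θ = hF.shiftDesc T hT c ψ hψ := by
  refine NatTrans.ext (funext fun k => ?_)
  obtain ⟨n⟩ := k
  exact hF.shiftDescApp_unique T hT c ψ n _ (hθ n)

include hT hψ in
/-- The shift principle, existence-and-uniqueness form. [cite: StacksProject, Tag 088A] -/
theorem existsUnique_shiftDesc :
    ∃! θ : F ⟶ T, ∀ n, F.map (homOfLE (Nat.le_add_left n c)).op ≫ θ.app ⟨n⟩ = ψ n :=
  ⟨hF.shiftDesc T hT c ψ hψ, hF.map_shiftDesc_app T hT c ψ hψ, hF.eq_shiftDesc T hT c ψ hψ⟩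

/-- Two morphisms of towers out of a formal tower agreeing after the shift `F_{c+n} → F_n` are equal.
[folklore] -/
theorem hom_ext_of_shift {θ θ' : F ⟶ T}
    (h : ∀ n, F.map (homOfLE (Nat.le_add_left n c)).op ≫ θ.app ⟨n⟩ =
      F.map (homOfLE (Nat.le_add_left n c)).op ≫ θ'.app ⟨n⟩) : θ = θ' := by
  refine NatTrans.ext (funext fun k => ?_)
  obtain ⟨n⟩ := k
  haveI := hF.epi_map (Nat.le_add_left n c)
  exact (cancel_epi _).mp (h n)

end IsFormalTower

end Literature.AlgebraicGeometry.Morphisms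

end
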